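import Mathlib
import Summits.NavierStokesRegularity.NavierStokesRegularity.Theorems.HeteroclinicTriggerChainTriggerChainFrontStepConnectionAlgebra
import HarnessLib

/-!
# `HeteroclinicTriggerChain` — crux `TriggerChainFrontStep` (item stmt-NavierStokesRegularity-22785):
  analytic consequences of the (connection) clause, I — energy, receiver monotonicity, `g ≤ e`

The crux hands the prover an exact entire lattice family `H` for the unseeded table `α₀`, supported on
shell `0` (all four modes) and on the receiver `(i₀,1)`, connecting the pure state at shell `0`
(`t → -∞`) to the pure state at shell `1` (`t → +∞`, complete transfer). With the row formulas of
`…ConnectionAlgebra` (normal form + parity) the five live amplitudes — carrier `x`, trigger `u`, junk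
modes `X_j` (`j ∉ {i₀,i₁}`) at shell `0`, receiver `y` at shell `1` — obey
`x' = -∑ⱼ d j 0 · X_j²`, `y' = ∑ⱼ g_j · X_j²` (`g_j := α j j i₀ (0,0,1) ≥ 0`), and we prove:

* `htcCF_energy_eq_one` — the two-shell energy `∑ᵢ X_{i,0}² + ∑ᵢ X_{i,1}²` is `≡ 1`;
* `htcCF_receiver_monotone` — the receiver is nondecreasing with `0 ≤ y ≤ 1`;
* `htcCF_transfer_le_trigger` — `L = g·x + e·y` is nondecreasing, hence the transfer rate
  `g = α i₁ i₁ i₀ (0,0,1)` satisfies `0 ≤ g ≤ e` (ALWAYS; `g < e` happens exactly when the connection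
  makes a junk excursion — the hypotheses of the crux do NOT pin `g = e`);
The sequel `…ConnectionJunkFree` proves the JUNK-FREE CRITERION (no trigger self-interaction into
junk modes ⇒ `H j 0 ≡ 0` for `j ∉ {i₀,i₁}`), and `…ConnectionArc` draws the consequences for junk-free
connections: `g = e`, `x + y = 1`, `u² = 2xy` (the connection IS the logistic arc), vanishing of the
trigger self-interaction rows, and the seed coefficient.

HONEST FRAMING: elementary ODE facts about five real functions driven by a Tao-type MODEL lattice table
(Tao 2016 §4); helper for the crux, no stub credit; nothing here is a statement about the Navier–Stokes
equations; no summit, rung or crux is proved by this file.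
-/

noncomputable section

set_option linter.dupNamespace false

namespace Summit.NavierStokesRegularity.NavierStokesRegularity.Theorems

open Filter Topology Set Literature.Analysis.FluidPDE Literature.Analysis.FluidPDE.TaoCascade

/-- Support bookkeeping: a family vanishing below shell `0`, above shell `1`, and off the carrier at
shells `≥ 1` is supported on shell `0` and the receiver `(i₀,1)`. [folklore] -/
theorem htcCF_support {H : Fin 4 → ℤ → ℝ → ℝ} {i₀ : Fin 4}
    (hneg : ∀ i n t, n < 0 → H i n t = 0) (hone : ∀ i n t, 1 ≤ n → i ≠ i₀ → H i n t = 0)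
    (htwo : ∀ i n t, 2 ≤ n → H i n t = 0) (t : ℝ) :
    (∀ i n, n ≠ 0 → n ≠ 1 → H i n t = 0) ∧ (∀ i, i ≠ i₀ → H i 1 t = 0) := by
  refine ⟨fun i n hn0 hn1 => ?_, fun i hi => hone i 1 t le_rfl hi⟩
  rcases lt_or_gt_of_ne hn0 with h | h
  · exact hneg i n t h
  · exact htwo i n t (by omega)

/-- **Two-shell energy is conserved and equal to one** along the connection: for a cancelling table
with `α i₀ i₀ · (0,0,0) = 0` and an exact family supported on shell `0` and the receiver, tending to
the pure state `δ_{(i₀,0)}` as `t → -∞`, `∑ᵢ H_{i,0}(t)² + ∑ᵢ H_{i,1}(t)² = 1` for all `t`. [this file] -/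
theorem htcCF_energy_eq_one (α : Fin 4 → Fin 4 → Fin 4 → ℤ × ℤ × ℤ → ℝ) (i₀ : Fin 4)
    (hcanc : IsCancellingCoeff α) (h000 : ∀ i : Fin 4, α i₀ i₀ i (0, 0, 0) = 0)
    (H : Fin 4 → ℤ → ℝ → ℝ)
    (hH : ∀ i n t, HasDerivAt (H i n) (quadTerm 1 α H i n t) t)
    (hneg : ∀ i n t, n < 0 → H i n t = 0) (hone : ∀ i n t, 1 ≤ n → i ≠ i₀ → H i n t = 0)
    (htwo : ∀ i n t, 2 ≤ n → H i n t = 0)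
    (hbot : ∀ i n, Tendsto (H i n) atBot (𝓝 (if i = i₀ ∧ n = 0 then (1 : ℝ) else 0))) (t : ℝ) :
    ∑ i, H i 0 t ^ 2 + ∑ i, H i 1 t ^ 2 = 1 := by
  set F : ℝ → ℝ := fun s => ∑ i, H i 0 s * H i 0 s + ∑ i, H i 1 s * H i 1 s with hF
  have hderiv : ∀ s, HasDerivAt F 0 s := by
    intro s
    have h := (HasDerivAt.fun_sum (u := Finset.univ)
        (fun i _ => (hH i 0 s).mul (hH i 0 s))).add
      (HasDerivAt.fun_sum (u := Finset.univ) (fun i _ => (hH i 1 s).mul (hH i 1 s)))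
    have hval : ∑ i ∈ Finset.univ, (quadTerm 1 α H i 0 s * H i 0 s + H i 0 s * quadTerm 1 α H i 0 s) +
        ∑ i ∈ Finset.univ, (quadTerm 1 α H i 1 s * H i 1 s + H i 1 s * quadTerm 1 α H i 1 s) = 0 := by
      obtain ⟨hX, hX1⟩ := htcCF_support hneg hone htwo s
      have hid := htcCA_energy_identity α i₀ hcanc h000 H s hX hX1
      have e1 : ∑ i ∈ Finset.univ, (quadTerm 1 α H i 0 s * H i 0 s + H i 0 s * quadTerm 1 α H i 0 s)
          = 2 * ∑ i, quadTerm 1 α H i 0 s * H i 0 s := by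
        rw [Finset.mul_sum]; exact Finset.sum_congr rfl fun i _ => by ring
      have e2 : ∑ i ∈ Finset.univ, (quadTerm 1 α H i 1 s * H i 1 s + H i 1 s * quadTerm 1 α H i 1 s)
          = 2 * ∑ i, quadTerm 1 α H i 1 s * H i 1 s := by
        rw [Finset.mul_sum]; exact Finset.sum_congr rfl fun i _ => by ring
      rw [e1, e2, ← mul_add, hid, mul_zero]
    rw [hval] at h
    exact h
  have hdiff : Differentiable ℝ F := fun s => (hderiv s).differentiableAt
  have hconst : ∀ s, F s = F t := fun s =>
    is_const_of_deriv_eq_zero hdiff (fun r => (hderiv r).deriv) s t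
  have hlim : Tendsto F atBot (𝓝 ((∑ i : Fin 4, (if i = i₀ ∧ (0 : ℤ) = 0 then (1 : ℝ) else 0) *
      (if i = i₀ ∧ (0 : ℤ) = 0 then (1 : ℝ) else 0)) + ∑ i : Fin 4,
      (if i = i₀ ∧ (1 : ℤ) = 0 then (1 : ℝ) else 0) * (if i = i₀ ∧ (1 : ℤ) = 0 then (1 : ℝ) else 0))) :=
    (tendsto_finsetSum _ fun i _ => (hbot i 0).mul (hbot i 0)).add
      (tendsto_finsetSum _ fun i _ => (hbot i 1).mul (hbot i 1))
  have hval : (∑ i : Fin 4, (if i = i₀ ∧ (0 : ℤ) = 0 then (1 : ℝ) else 0) *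
      (if i = i₀ ∧ (0 : ℤ) = 0 then (1 : ℝ) else 0)) + ∑ i : Fin 4,
      (if i = i₀ ∧ (1 : ℤ) = 0 then (1 : ℝ) else 0) * (if i = i₀ ∧ (1 : ℤ) = 0 then (1 : ℝ) else 0) = 1 := by
    simp
  rw [hval] at hlim
  have hFt : F t = 1 :=
    tendsto_nhds_unique (tendsto_const_nhds.congr fun s => (hconst s).symm) hlim
  have : F t = ∑ i, H i 0 t ^ 2 + ∑ i, H i 1 t ^ 2 := by
    simp only [hF, sq]
  rw [← this, hFt]

/-- The pump gains are nonnegative: `0 ≤ α j j i₀ (0,0,1)` for every mode `j`, because the normal form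
ties them to the rate table behind the front, `d j (-1) = -2^{-5/2}·α j j i₀ (0,0,1)`, and the (saddle)
sign clause gives `d j (-1) ≤ 0`. [this file] -/
theorem htcCF_pump_nonneg (α : Fin 4 → Fin 4 → Fin 4 → ℤ × ℤ × ℤ → ℝ) (i₀ i₁ : Fin 4)
    (d : Fin 4 → ℤ → ℝ)
    (hsym : IsSymmetricCoeff α) (hcanc : IsCancellingCoeff α)
    (hpure : ∀ X : Fin 4 → ℤ → ℝ → ℝ, (∀ i n t, i ≠ i₀ → X i n t = 0) →
      ∀ i n t, quadTerm 1 α X i n t = 0)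
    (hsad : ∀ (Y : Fin 4 → ℤ → ℝ → ℝ) (i : Fin 4) (n : ℤ) (t : ℝ),
      quadTerm 1 α (fun j m s => (fun j m (_ : ℝ) => if j = i₀ ∧ m = 0 then (1 : ℝ) else 0) j m s +
          Y j m s) i n t -
        quadTerm 1 α (fun j m (_ : ℝ) => if j = i₀ ∧ m = 0 then (1 : ℝ) else 0) i n t -
        quadTerm 1 α Y i n t = d i n * Y i n t)
    (hdle : ∀ (i : Fin 4) (n : ℤ), ¬(i = i₁ ∧ n = 0) → d i n ≤ 0) (j : Fin 4) :
    0 ≤ α j j i₀ (0, 0, 1) := by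
  obtain ⟨-, -, -, -, -, -, -, -, nf9⟩ :=
    HeteroclinicTriggerChain.stub_normal_form α i₀ d hsym hcanc hpure hsad
  have h1 := (nf9 j).2.2.2
  have h2 : d j (-1) ≤ 0 := hdle j (-1) (by simp)
  have hw : (0 : ℝ) < (2 : ℝ) ^ (-((5 : ℝ) / 2)) := by positivity
  nlinarith

/-- **The receiver is nondecreasing and stays in `[0,1]`** along the connection: `y' = ∑ⱼ g_j X_j² ≥ 0`
with `y → 0` at `-∞` and `y → 1` at `+∞`. [this file] -/
theorem htcCF_receiver_monotone (α : Fin 4 → Fin 4 → Fin 4 → ℤ × ℤ × ℤ → ℝ) (i₀ i₁ : Fin 4)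
    (d : Fin 4 → ℤ → ℝ)
    (hsym : IsSymmetricCoeff α) (hcanc : IsCancellingCoeff α)
    (hpure : ∀ X : Fin 4 → ℤ → ℝ → ℝ, (∀ i n t, i ≠ i₀ → X i n t = 0) →
      ∀ i n t, quadTerm 1 α X i n t = 0)
    (hsad : ∀ (Y : Fin 4 → ℤ → ℝ → ℝ) (i : Fin 4) (n : ℤ) (t : ℝ),
      quadTerm 1 α (fun j m s => (fun j m (_ : ℝ) => if j = i₀ ∧ m = 0 then (1 : ℝ) else 0) j m s +
          Y j m s) i n t -
        quadTerm 1 α (fun j m (_ : ℝ) => if j = i₀ ∧ m = 0 then (1 : ℝ) else 0) i n t -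
        quadTerm 1 α Y i n t = d i n * Y i n t)
    (hdle : ∀ (i : Fin 4) (n : ℤ), ¬(i = i₁ ∧ n = 0) → d i n ≤ 0)
    (H : Fin 4 → ℤ → ℝ → ℝ)
    (hH : ∀ i n t, HasDerivAt (H i n) (quadTerm 1 α H i n t) t)
    (hneg : ∀ i n t, n < 0 → H i n t = 0) (hone : ∀ i n t, 1 ≤ n → i ≠ i₀ → H i n t = 0)
    (htwo : ∀ i n t, 2 ≤ n → H i n t = 0)
    (hbot : ∀ i n, Tendsto (H i n) atBot (𝓝 (if i = i₀ ∧ n = 0 then (1 : ℝ) else 0)))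
    (htop : ∀ i n, Tendsto (H i n) atTop (𝓝 (if i = i₀ ∧ n = 1 then (1 : ℝ) else 0))) :
    (∀ t, HasDerivAt (H i₀ 1) (∑ j, α j j i₀ (0, 0, 1) * H j 0 t ^ 2) t) ∧
      Monotone (H i₀ 1) ∧ ∀ t, 0 ≤ H i₀ 1 t ∧ H i₀ 1 t ≤ 1 := by
  have hy : ∀ t, HasDerivAt (H i₀ 1) (∑ j, α j j i₀ (0, 0, 1) * H j 0 t ^ 2) t := by
    intro t
    obtain ⟨hX, hX1⟩ := htcCF_support hneg hone htwo t
    rw [← htcCA_quadTerm_receiver α i₀ d hsym hcanc hpure hsad H t hX hX1]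
    exact hH i₀ 1 t
  have hmono : Monotone (H i₀ 1) :=
    monotone_of_deriv_nonneg (fun t => (hy t).differentiableAt) fun t => by
      rw [(hy t).deriv]
      exact Finset.sum_nonneg fun j _ =>
        mul_nonneg (htcCF_pump_nonneg α i₀ i₁ d hsym hcanc hpure hsad hdle j) (sq_nonneg _)
  have hb : Tendsto (H i₀ 1) atBot (𝓝 0) := by simpa using hbot i₀ 1
  have ht : Tendsto (H i₀ 1) atTop (𝓝 1) := by simpa using htop i₀ 1
  exact ⟨hy, hmono, fun t => ⟨hmono.le_of_tendsto hb t, hmono.ge_of_tendsto ht t⟩⟩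

/-- **The transfer rate never exceeds the trigger rate: `0 ≤ g ≤ e`**, `g := α i₁ i₁ i₀ (0,0,1)`,
`e := d i₁ 0`. Along the connection `L = g·x + e·y` has `L' = ∑_{junk j} (e·g_j - g·d_j(0))·X_j² ≥ 0`
(the trigger's contributions `-g·e·u²` and `+e·g·u²` cancel), and `L → g` at `-∞`, `L → e` at `+∞`.
Equality `g = e` is NOT forced by the crux's hypotheses (junk excursions with `g < e` exist); see
`…ConnectionArc` for the junk-free case. [this file] -/
theorem htcCF_transfer_le_trigger (α : Fin 4 → Fin 4 → Fin 4 → ℤ × ℤ × ℤ → ℝ) (i₀ i₁ : Fin 4)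
    (d : Fin 4 → ℤ → ℝ) (e : ℝ) (he : 0 < e)
    (hsym : IsSymmetricCoeff α) (hcanc : IsCancellingCoeff α)
    (hpure : ∀ X : Fin 4 → ℤ → ℝ → ℝ, (∀ i n t, i ≠ i₀ → X i n t = 0) →
      ∀ i n t, quadTerm 1 α X i n t = 0)
    (hsad : ∀ (Y : Fin 4 → ℤ → ℝ → ℝ) (i : Fin 4) (n : ℤ) (t : ℝ),
      quadTerm 1 α (fun j m s => (fun j m (_ : ℝ) => if j = i₀ ∧ m = 0 then (1 : ℝ) else 0) j m s +
          Y j m s) i n t -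
        quadTerm 1 α (fun j m (_ : ℝ) => if j = i₀ ∧ m = 0 then (1 : ℝ) else 0) i n t -
        quadTerm 1 α Y i n t = d i n * Y i n t)
    (hde : d i₁ 0 = e) (hdle : ∀ (i : Fin 4) (n : ℤ), ¬(i = i₁ ∧ n = 0) → d i n ≤ 0)
    (H : Fin 4 → ℤ → ℝ → ℝ)
    (hH : ∀ i n t, HasDerivAt (H i n) (quadTerm 1 α H i n t) t)
    (hneg : ∀ i n t, n < 0 → H i n t = 0) (hone : ∀ i n t, 1 ≤ n → i ≠ i₀ → H i n t = 0)
    (htwo : ∀ i n t, 2 ≤ n → H i n t = 0)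
    (hbot : ∀ i n, Tendsto (H i n) atBot (𝓝 (if i = i₀ ∧ n = 0 then (1 : ℝ) else 0)))
    (htop : ∀ i n, Tendsto (H i n) atTop (𝓝 (if i = i₀ ∧ n = 1 then (1 : ℝ) else 0))) :
    0 ≤ α i₁ i₁ i₀ (0, 0, 1) ∧ α i₁ i₁ i₀ (0, 0, 1) ≤ e := by
  have hg : ∀ j, 0 ≤ α j j i₀ (0, 0, 1) :=
    htcCF_pump_nonneg α i₀ i₁ d hsym hcanc hpure hsad hdle
  refine ⟨hg i₁, ?_⟩
  set g := α i₁ i₁ i₀ (0, 0, 1) with hgdef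
  set L : ℝ → ℝ := fun s => g * H i₀ 0 s + e * H i₀ 1 s with hL
  have hLd : ∀ s, HasDerivAt L (∑ j, (e * α j j i₀ (0, 0, 1) - g * d j 0) * H j 0 s ^ 2) s := by
    intro s
    obtain ⟨hX, hX1⟩ := htcCF_support hneg hone htwo s
    have hx := hH i₀ 0 s
    rw [htcCA_quadTerm_carrier α i₀ d hsym hcanc hpure hsad H s hX hX1] at hx
    have hy := hH i₀ 1 s
    rw [htcCA_quadTerm_receiver α i₀ d hsym hcanc hpure hsad H s hX hX1] at hy
    have h := (hx.const_mul g).add (hy.const_mul e)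
    refine h.congr_deriv ?_
    have hre : ∑ j, (e * α j j i₀ (0, 0, 1) - g * d j 0) * H j 0 s ^ 2 =
        -(g * ∑ j, d j 0 * H j 0 s ^ 2) + e * ∑ j, α j j i₀ (0, 0, 1) * H j 0 s ^ 2 := by
      rw [Finset.mul_sum, Finset.mul_sum, ← Finset.sum_neg_distrib, ← Finset.sum_add_distrib]
      exact Finset.sum_congr rfl fun j _ => by ring
    rw [hre]
    ring
  have hmono : Monotone L :=
    monotone_of_deriv_nonneg (fun s => (hLd s).differentiableAt) fun s => by
      rw [(hLd s).deriv]
      refine Finset.sum_nonneg fun j _ => mul_nonneg ?_ (sq_nonneg _)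
      by_cases hj : j = i₁
      · rw [hj, hde, ← hgdef]; linarith
      · have h1 : d j 0 ≤ 0 := hdle j 0 (fun h => hj h.1)
        nlinarith [hg j, hg i₁, h1, he.le]
  have h0b : Tendsto (H i₀ 0) atBot (𝓝 1) := by simpa using hbot i₀ 0
  have h1b : Tendsto (H i₀ 1) atBot (𝓝 0) := by simpa using hbot i₀ 1
  have h0t : Tendsto (H i₀ 0) atTop (𝓝 0) := by simpa using htop i₀ 0
  have h1t : Tendsto (H i₀ 1) atTop (𝓝 1) := by simpa using htop i₀ 1
  have hLb : Tendsto L atBot (𝓝 g) := by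
    have h := (h0b.const_mul g).add (h1b.const_mul e)
    simpa using h
  have hLt : Tendsto L atTop (𝓝 e) := by
    have h := (h0t.const_mul g).add (h1t.const_mul e)
    simpa using h
  exact (hmono.le_of_tendsto hLb 0).trans (hmono.ge_of_tendsto hLt 0)

end Summit.NavierStokesRegularity.NavierStokesRegularity.Theorems

end
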